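import Mathlib
import HarnessLib
import Summits.NavierStokesRegularity.NavierStokesRegularity.Theorems.PoloidalWindowDoorPoloidalWindowRigidityUntwistedLeafwiseGerm

/-!
# Route `PoloidalWindowDoor`, item `LrcModEntire` (stmt-NavierStokesRegularity-20428) / crux K2 (stmt-19708), line `twist-split` /
# `lrc-jet` v5 — THE UNTWISTED ASSEMBLY IN GERM CURRENCY: NORMAL FORM ON AN OPEN SET OF ONE SLICE ⇒ THE `LrcModEntire` GERM

Cell ns-regularity-ideate, seat ns-poloidal-K2-p3 (gen 6, LEAD of item 20428; `--supports stmt-NavierStokesRegularity-20428`, helper toward the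
registered stub `stub_untwistedGerm` of `Cruxes/LrcModEntire/Lines/twist_split.lean`, and toward the K2 lead's `stub_untwisted` of
`Cruxes/PoloidalWindowRigidity/Lines/lrc_jet.lean` v5 via the transfer `stub_untwisted_of_germStub`).  Paper proof: UNTWISTED-NOTE.md §3.

THE DICHOTOMY OF THE SEPARATION, assembled.  Input (= the output of brick F2, ns-poloidal-K2-p2 g5, in the hypothesis format of the K2 lead's
F3a/F3b files): a profile `v` of the route's Type-I class, poloidal along `e₃`; a slice `s < 0`, `w = v₂(s,·)`; an open `U ∋ y₀` on which
* `∂₂w = P(w,y₂)` (UNTWISTED; `P` analytic at the leaf points),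
* the slope `Λ` (analytic at the leaf points) avoids `0` and `1` (the pins `∂₂vₕ ≠ 0`, `curl v ≠ 0`), and `∇ₕw ≠ 0` (the pin `∇ₕv₂ ≠ 0`),
* the leafwise DIVERGENCE identity `(K1)`: `Λ·Δₕw + Λ_w·|∇ₕw|² + c(w,y₂) = 0` with `c = Ṗ := DP(w,y₂)(P,1) = ∂₂²w` at the leaf points
  (`…UntwistedKinematics.fderiv_vert_vert`; `c` differentiable there),
* the DYNAMIC identity `(V0)`: `(1−Λ)·S = (1−Λ)·Δₕw − Λ_w·|∇ₕw|² + k(w,y₂)` for a differentiable scalar `S` (`= vₕ·∇ₕw + ∂ₜw`) with the transport rule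
  `∂₂S = P_w·S + Λ·|∇ₕw|² + p_t(w,y₂)`.
Output: EITHER the germ trichotomy of `LrcModEntire` on the slice `s` (first two legs) OR the data of the STUART BRANCH on an open `U' ∋ y₀`: a
horizontal index `b` with `∂_bw ≠ 0` on `U'` and the three pointwise relations `D₁ = 0`, `D₂ = 0` (`Λ·P̈ = (Λ̇ + ΛP_w)·Ṗ`), `D₃ = 0` — VERBATIM the
hypotheses of the K2 lead's `…UntwistedStuartTranslation3.branch2b_false` (which turns them into `False`; that file is in the gate, so the one-line
combination is the sequel).  Proof: if the Wronskian `D₁` of F3a or `D₃` of F3b is non-zero at ONE point of `U`,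
`…UntwistedLeafwiseGerm.lrcGerm_of_wronskian{₁,₃}_ne_zero` (isoparametric leaves ⇒ Segre ⇒ vertical propagation ⇒ Clebsch germ ⇒ vorticity germ);
otherwise `D₁ ≡ D₃ ≡ 0` on `U`, and `D₂` follows from `(K1)`, its height-derivative (`vert_deriv_divIdentity`) and `D₁ = 0` by three lines of algebra
(`ċ = P̈` at the leaf points because `c = Ṗ` there and `U` is open).

* `dotP_consistency_of_wronskian₁_eq_zero` — the three-line algebra for `D₂`.
* `lrcGerm_or_stuartBranch_of_untwistedNormalForm` — the assembled dichotomy.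

WHAT THIS IS NOT: not a claim about Navier–Stokes regularity and not yet `stub_untwistedGerm` — the remaining inputs are brick F2 (the normal form
itself for class profiles) and the landing of `branch2b_false` (bears_on LADDER-NS N0 via items 20428 / 19708).
-/

noncomputable section

-- the summit and its single sub-problem share the name (CONVENTIONS §1), as in every Theorems file
set_option linter.dupNamespace false

namespace Summit.NavierStokesRegularity.NavierStokesRegularity.Theorems.PoloidalWindowDoorLrcModEntireUntwistedNormalForm

open Set Function Filter Topology Metric
open scoped RealInnerProductSpace InnerProductSpace ContDiff
open Literature.Analysis Literature.Analysis.FluidPDE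
open Summit.NavierStokesRegularity.NavierStokesRegularity.Theorems.LocalSineTubeDoorProfileAlignedWindowRigidityAncient
open Summit.NavierStokesRegularity.NavierStokesRegularity.Theorems.PoloidalWindowDoorPoloidalWindowRigidityConstantShearMeans
open Summit.NavierStokesRegularity.NavierStokesRegularity.Theorems.PoloidalWindowDoorLrcModEntireLeafwiseVertical
open Summit.NavierStokesRegularity.NavierStokesRegularity.Theorems.PoloidalWindowDoorPoloidalWindowRigidityUntwistedSeparation
open Summit.NavierStokesRegularity.NavierStokesRegularity.Theorems.PoloidalWindowDoorPoloidalWindowRigidityUntwistedLeafwiseGerm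

/-! ### The consistency relation `D₂` in the degenerate branch -/

/-- **`D₁ = 0 ⇒ D₂ = 0` (three-line algebra).**  From the divergence identity `Λ·M + Λ_w·E + c = 0`, its height-derivative
`(Λ̇ + ΛP_w)·M + X·E + ċ = 0` (`X = ΛP_ww + Λ̇_w + 2Λ_wP_w`) and `D₁ = Λ·X − Λ_w·(Λ̇ + ΛP_w) = 0` one gets `Λ·ċ = (Λ̇ + ΛP_w)·c`, whatever `M, E`.
[folklore] -/
theorem dotP_consistency_of_wronskian₁_eq_zero {L Lw Ld Pw X M E c cd : ℝ}
    (h1 : L * M + Lw * E + c = 0) (h2 : (Ld + L * Pw) * M + X * E + cd = 0) (hD1 : L * X - Lw * (Ld + L * Pw) = 0) :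
    L * cd = (Ld + L * Pw) * c := by
  linear_combination L * h2 - (Ld + L * Pw) * h1 - E * hD1

/-! ### The assembled dichotomy -/

variable {C : ℝ} {v : ℝ → EuclideanSpace ℝ (Fin 3) → EuclideanSpace ℝ (Fin 3)}

/-- **THE UNTWISTED NORMAL FORM ON AN OPEN SET OF ONE SLICE ⇒ THE `LrcModEntire` GERM.**  Let `v` be a profile of the route's Type-I class, poloidal
along `e₃`, `s < 0`, `w = v₂(s,·)`, `U` open, `y₀ ∈ U`; let `P, Λ, c, k, p_t : ℝ × ℝ → ℝ` and `S : ℝ³ → ℝ` with `P, Λ` of class `C²` at the leaf points of `U`,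
`c, k` differentiable there with `c = Ṗ` at the leaf points, `S` differentiable on `U`; suppose on `U`: `∂₂w = P(w,y₂)`, `Λ ∉ {0,1}`, `∇ₕw ≠ 0`,
the divergence identity `(K1)`, the dynamic identity `(V0)` and the transport rule for `S` (the hypothesis format of `…UntwistedSeparation{,2}`).  Then on some slice `s' < 0`
and some nonempty open `U'` the vorticity has a translation germ or a rotation germ about a vertical axis (or the entire leg): the conclusion of item
`LrcModEntire`, VERBATIM — or the Stuart-branch data on an open `U' ∋ y₀` (the hypotheses of the lead's `branch2b_false`).  (Dichotomy on the
Wronskians `D₁`, `D₃`: non-zero at one point ⇒ `…UntwistedLeafwiseGerm`; both `≡ 0` ⇒ `D₂` by `dotP_consistency_of_wronskian₁_eq_zero`.) [folklore] -/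
theorem lrcGerm_or_stuartBranch_of_untwistedNormalForm (hrate : HasTypeITimeDecay C v)
    (hcont : ContinuousOn (uncurry v) (Iio (0 : ℝ) ×ˢ univ))
    (hmild : ∀ s t : ℝ, s < t → t < 0 → ∀ x,
      v t x = UnboundedOperators.heatExtension (v s) (t - s) x - oseenDuhamel 1 s v v t x)
    (hdiv : ∀ t < 0, VectorCalculus.IsDivFree (v t))
    (hpol : ∀ s < 0, ∀ y, ⟪curl (v s) y, EuclideanSpace.single 2 1⟫_ℝ = 0)
    {s : ℝ} (hs : s < 0) {w : EuclideanSpace ℝ (Fin 3) → ℝ} (hwv : w = fun x => v s x 2)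
    {P Λ c k pt : ℝ × ℝ → ℝ} {S : EuclideanSpace ℝ (Fin 3) → ℝ} {U : Set (EuclideanSpace ℝ (Fin 3))} (hU : IsOpen U)
    {y₀ : EuclideanSpace ℝ (Fin 3)} (hy₀ : y₀ ∈ U)
    (hPd : ∀ y ∈ U, ContDiffAt ℝ 2 P (w y, y 2)) (hΛd : ∀ y ∈ U, ContDiffAt ℝ 2 Λ (w y, y 2))
    (hcd : ∀ y ∈ U, DifferentiableAt ℝ c (w y, y 2)) (hkd : ∀ y ∈ U, DifferentiableAt ℝ k (w y, y 2))
    (hSd : ∀ y ∈ U, DifferentiableAt ℝ S y)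
    (hL0 : ∀ y ∈ U, Λ (w y, y 2) ≠ 0)
    (hnd : ∀ y ∈ U, fderiv ℝ w y (EuclideanSpace.single 0 (1 : ℝ)) ≠ 0 ∨ fderiv ℝ w y (EuclideanSpace.single 1 (1 : ℝ)) ≠ 0)
    (hP : ∀ y ∈ U, fderiv ℝ w y (EuclideanSpace.single 2 (1 : ℝ)) = P (w y, y 2))
    (hcP : ∀ y ∈ U, c (w y, y 2) = fderiv ℝ P (w y, y 2) (P (w y, y 2), 1))
    (hK1 : ∀ y ∈ U, Λ (w y, y 2) *
        (fderiv ℝ (fun y' => fderiv ℝ w y' (EuclideanSpace.single 0 (1 : ℝ))) y (EuclideanSpace.single 0 (1 : ℝ)) +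
          fderiv ℝ (fun y' => fderiv ℝ w y' (EuclideanSpace.single 1 (1 : ℝ))) y (EuclideanSpace.single 1 (1 : ℝ))) +
      fderiv ℝ Λ (w y, y 2) (1, 0) *
        (fderiv ℝ w y (EuclideanSpace.single 0 (1 : ℝ)) ^ 2 + fderiv ℝ w y (EuclideanSpace.single 1 (1 : ℝ)) ^ 2) +
      c (w y, y 2) = 0)
    (hV0 : ∀ y ∈ U, (1 - Λ (w y, y 2)) * S y = (1 - Λ (w y, y 2)) *
        (fderiv ℝ (fun y' => fderiv ℝ w y' (EuclideanSpace.single 0 (1 : ℝ))) y (EuclideanSpace.single 0 (1 : ℝ)) +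
          fderiv ℝ (fun y' => fderiv ℝ w y' (EuclideanSpace.single 1 (1 : ℝ))) y (EuclideanSpace.single 1 (1 : ℝ))) -
      fderiv ℝ Λ (w y, y 2) (1, 0) *
        (fderiv ℝ w y (EuclideanSpace.single 0 (1 : ℝ)) ^ 2 + fderiv ℝ w y (EuclideanSpace.single 1 (1 : ℝ)) ^ 2) + k (w y, y 2))
    (hSz : ∀ y ∈ U, fderiv ℝ S y (EuclideanSpace.single 2 (1 : ℝ)) =
      fderiv ℝ P (w y, y 2) (1, 0) * S y + Λ (w y, y 2) *
        (fderiv ℝ w y (EuclideanSpace.single 0 (1 : ℝ)) ^ 2 + fderiv ℝ w y (EuclideanSpace.single 1 (1 : ℝ)) ^ 2) + pt (w y, y 2)) :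
    (∃ s' : ℝ, s' < 0 ∧ ∃ U' : Set (EuclideanSpace ℝ (Fin 3)), IsOpen U' ∧ U'.Nonempty ∧
      ((∃ e : EuclideanSpace ℝ (Fin 3), e ≠ 0 ∧ ∀ y ∈ U', fderiv ℝ (curl (v s')) y e = 0) ∨
       (∃ c : EuclideanSpace ℝ (Fin 3), ∀ y ∈ U',
          rotGen (curl (v s') y) = fderiv ℝ (curl (v s')) y (rotGen (y - c))) ∨
       (∃ w : EuclideanSpace ℝ (Fin 3) → EuclideanSpace ℝ (Fin 3), AnalyticOnNhd ℝ w univ ∧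
          ¬ BddAbove (Set.range fun y => ‖w y‖) ∧ ∀ y ∈ U', v s' y = w y))) ∨
    (∃ U' : Set (EuclideanSpace ℝ (Fin 3)), IsOpen U' ∧ y₀ ∈ U' ∧ U' ⊆ U ∧ ∃ b : Fin 3, b ≠ 2 ∧
      (∀ y ∈ U', fderiv ℝ w y (EuclideanSpace.single b (1 : ℝ)) ≠ 0) ∧
      (∀ y ∈ U',
        Λ (w y, y 2) * (Λ (w y, y 2) * fderiv ℝ (fun q => fderiv ℝ P q ((1 : ℝ), (0 : ℝ))) (w y, y 2) (1, 0) +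
              fderiv ℝ (fun q => fderiv ℝ Λ q ((1 : ℝ), (0 : ℝ))) (w y, y 2) (P (w y, y 2), 1) +
              2 * fderiv ℝ Λ (w y, y 2) (1, 0) * fderiv ℝ P (w y, y 2) (1, 0)) -
            fderiv ℝ Λ (w y, y 2) (1, 0) * (fderiv ℝ Λ (w y, y 2) (P (w y, y 2), 1) + Λ (w y, y 2) * fderiv ℝ P (w y, y 2) (1, 0)) = 0) ∧
      (∀ y ∈ U',
        Λ (w y, y 2) * fderiv ℝ (fun q => fderiv ℝ P q (P q, 1)) (w y, y 2) (P (w y, y 2), 1) =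
          (fderiv ℝ Λ (w y, y 2) (P (w y, y 2), 1) + Λ (w y, y 2) * fderiv ℝ P (w y, y 2) (1, 0)) *
            fderiv ℝ P (w y, y 2) (P (w y, y 2), 1)) ∧
      (∀ y ∈ U',
        (Λ (w y, y 2) * (1 - Λ (w y, y 2))) *
              (Λ (w y, y 2) * (1 - Λ (w y, y 2)) * Λ (w y, y 2) +
                fderiv ℝ (fun q => fderiv ℝ Λ q ((1 : ℝ), (0 : ℝ))) (w y, y 2) (P (w y, y 2), 1) +
                2 * fderiv ℝ Λ (w y, y 2) (1, 0) * fderiv ℝ P (w y, y 2) (1, 0)) -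
            fderiv ℝ Λ (w y, y 2) (1, 0) *
              ((1 - 2 * Λ (w y, y 2)) * fderiv ℝ Λ (w y, y 2) (P (w y, y 2), 1) +
                Λ (w y, y 2) * (1 - Λ (w y, y 2)) * fderiv ℝ P (w y, y 2) (1, 0)) = 0)) := by
  -- regularity of the data
  have hA : AnalyticOnNhd ℝ (v s) univ := analyticOnNhd_slice hcont (bdd_of_hasTypeITimeDecay hrate) hmild hs
  have hwA : AnalyticOnNhd ℝ w univ := by
    rw [hwv]
    intro x _
    exact ((EuclideanSpace.proj (𝕜 := ℝ) (2 : Fin 3)).analyticAt _).comp (hA x (mem_univ x))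
  have hw3 : ContDiff ℝ 3 w := hwA.contDiff
  have hP2 : ∀ y ∈ U, ContDiffAt ℝ 2 P (w y, y 2) := hPd
  have hΛ2 : ∀ y ∈ U, ContDiffAt ℝ 2 Λ (w y, y 2) := hΛd
  have hwd : Differentiable ℝ w := hw3.differentiable (by norm_num)
  -- `Ṗ : q ↦ DP(q)(P q, 1)` is differentiable at the leaf points, and `ċ = P̈` there (since `c = Ṗ` on the leaf points of the open `U`)
  have hPfd : ∀ y ∈ U, DifferentiableAt ℝ (fun q : ℝ × ℝ => fderiv ℝ P q (P q, 1)) (w y, y 2) := by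
    intro y hy
    have h1 : ContDiffAt ℝ 1 (fderiv ℝ P) (w y, y 2) := (hPd y hy).fderiv_right (m := 1) (by norm_num)
    have h2 : ContDiffAt ℝ 1 (fun q : ℝ × ℝ => (P q, (1 : ℝ))) (w y, y 2) :=
      ((hPd y hy).of_le (by norm_num)).prodMk contDiffAt_const
    exact (h1.clm_apply h2).differentiableAt one_ne_zero
  have hcdot : ∀ y ∈ U, fderiv ℝ c (w y, y 2) (P (w y, y 2), 1) =
      fderiv ℝ (fun q : ℝ × ℝ => fderiv ℝ P q (P q, 1)) (w y, y 2) (P (w y, y 2), 1) := by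
    intro y hy
    have h1 := fderiv_leaf_comp_vertical (hcd y hy) (hwd y)
    have h2 := fderiv_leaf_comp_vertical (hPfd y hy) (hwd y)
    rw [hP y hy] at h1 h2
    have heq : (fun y' : EuclideanSpace ℝ (Fin 3) => c (w y', y' 2)) =ᶠ[𝓝 y]
        fun y' => fderiv ℝ P (w y', y' 2) (P (w y', y' 2), 1) :=
      eventually_of_mem (hU.mem_nhds hy) fun y' hy' => hcP y' hy'
    rw [← h1, ← h2, heq.fderiv_eq]
  have hK1c := hK1
  -- DICHOTOMY on the two Wronskians
  by_cases h₁ : ∃ y₁ ∈ U,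
      Λ (w y₁, y₁ 2) * (Λ (w y₁, y₁ 2) * fderiv ℝ (fun q => fderiv ℝ P q ((1 : ℝ), (0 : ℝ))) (w y₁, y₁ 2) (1, 0) +
            fderiv ℝ (fun q => fderiv ℝ Λ q ((1 : ℝ), (0 : ℝ))) (w y₁, y₁ 2) (P (w y₁, y₁ 2), 1) +
            2 * fderiv ℝ Λ (w y₁, y₁ 2) (1, 0) * fderiv ℝ P (w y₁, y₁ 2) (1, 0)) -
          fderiv ℝ Λ (w y₁, y₁ 2) (1, 0) *
            (fderiv ℝ Λ (w y₁, y₁ 2) (P (w y₁, y₁ 2), 1) + Λ (w y₁, y₁ 2) * fderiv ℝ P (w y₁, y₁ 2) (1, 0)) ≠ 0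
  · -- BRANCH 1
    obtain ⟨y₁, hy₁, hD⟩ := h₁
    exact Or.inl (lrcGerm_of_wronskian₁_ne_zero hrate hcont hmild hdiv hpol hs hwv hU hP2 hΛ2 hcd hP hK1c hy₁ hD (hnd y₁ hy₁))
  by_cases h₃ : ∃ y₁ ∈ U,
      (Λ (w y₁, y₁ 2) * (1 - Λ (w y₁, y₁ 2))) *
            (Λ (w y₁, y₁ 2) * (1 - Λ (w y₁, y₁ 2)) * Λ (w y₁, y₁ 2) +
              fderiv ℝ (fun q => fderiv ℝ Λ q ((1 : ℝ), (0 : ℝ))) (w y₁, y₁ 2) (P (w y₁, y₁ 2), 1) +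
              2 * fderiv ℝ Λ (w y₁, y₁ 2) (1, 0) * fderiv ℝ P (w y₁, y₁ 2) (1, 0)) -
          fderiv ℝ Λ (w y₁, y₁ 2) (1, 0) *
            ((1 - 2 * Λ (w y₁, y₁ 2)) * fderiv ℝ Λ (w y₁, y₁ 2) (P (w y₁, y₁ 2), 1) +
              Λ (w y₁, y₁ 2) * (1 - Λ (w y₁, y₁ 2)) * fderiv ℝ P (w y₁, y₁ 2) (1, 0)) ≠ 0
  · -- BRANCH 2a
    obtain ⟨y₁, hy₁, hD⟩ := h₃
    exact Or.inl (lrcGerm_of_wronskian₃_ne_zero hrate hcont hmild hdiv hpol hs hwv hU hP2 hΛ2 hcd hkd hSd hL0 hP hSz hK1c hV0 hy₁ hD (hnd y₁ hy₁))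
  · -- BRANCH 2b: `D₁ ≡ D₃ ≡ 0` on `U` — the Stuart branch, empty
    push Not at h₁ h₃
    right
    -- a fixed horizontal index `b` with `∂_b w ≠ 0` on an open `U' ∋ y₀`
    obtain ⟨b, hb, hb0⟩ : ∃ b : Fin 3, b ≠ 2 ∧ fderiv ℝ w y₀ (EuclideanSpace.single b (1 : ℝ)) ≠ 0 := by
      rcases hnd y₀ hy₀ with h | h
      · exact ⟨0, by decide, h⟩
      · exact ⟨1, by decide, h⟩
    have hbc : ContinuousAt (fun y => fderiv ℝ w y (EuclideanSpace.single b (1 : ℝ))) y₀ :=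
      ((hw3.continuous_fderiv (by norm_num)).clm_apply continuous_const).continuousAt
    obtain ⟨U', hU'sub, hU'o, hy₀'⟩ := _root_.mem_nhds_iff.1 ((show ∀ᶠ y in 𝓝 y₀, y ∈ U from hU.mem_nhds hy₀).and (hbc.eventually_ne hb0))
    have hU'U : U' ⊆ U := fun y hy => (hU'sub hy).1
    -- the consistency relation `D₂` on `U`
    have hD2 : ∀ y ∈ U,
        Λ (w y, y 2) * fderiv ℝ (fun q => fderiv ℝ P q (P q, 1)) (w y, y 2) (P (w y, y 2), 1) =
          (fderiv ℝ Λ (w y, y 2) (P (w y, y 2), 1) + Λ (w y, y 2) * fderiv ℝ P (w y, y 2) (1, 0)) *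
            fderiv ℝ P (w y, y 2) (P (w y, y 2), 1) := by
      intro y hy
      have e1 := hK1c y hy
      have e2 := vert_deriv_divIdentity hU hw3 hP2 hΛ2 hcd hP hK1c hy
      have e3 := dotP_consistency_of_wronskian₁_eq_zero e1 e2 (sub_eq_zero.2 (by
        have := h₁ y hy
        linear_combination this))
      rw [hcdot y hy, hcP y hy] at e3
      exact e3
    exact ⟨U', hU'o, hy₀', hU'U, b, hb, fun y hy => (hU'sub hy).2, fun y hy => h₁ y (hU'U hy), fun y hy => hD2 y (hU'U hy),
      fun y hy => h₃ y (hU'U hy)⟩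

end Summit.NavierStokesRegularity.NavierStokesRegularity.Theorems.PoloidalWindowDoorLrcModEntireUntwistedNormalForm

end
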